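import Summits.QuantumFields.YangMills.Theorems.LevelShiftBootstrapHistoryTailOfLocalStabilityChain

/-!
# The level-shift bootstrap, part 4: the depth threshold `h₀` — helper toward `LevelShiftBootstrap.HistoryTailOfLocalStability`
# (stmt-QuantumFields-26949), route-independent (no `Theses` import)

Width seat `ym-line-sfw-p2-w3` g22 (home cell `ym-idea-1`), `--supports stmt-QuantumFields-26949`.

WHAT.  Pure real analysis.  Along the refinement depth `i` of one family (block size `L`, volume exponent `m_F`, coupling `γ ≤ 1`) put
`p_i = b₀x_i^P` (`x_i = x₀ + δi`, Bałaban's profile at a natural exponent, part 1 `pFun_sqrt_eq`), `R_i = R·p_i·(m_F + i + 1)^q` (the crux's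
accumulated slack for the family refined `i` times), the brute-force unit tail `A_i = C₁·β_i^A·e^{−a p_i²}` (`β_i = e^{i log L − log γ}`), the
induction bound `B_i = 3e^{R_i + 1}A_i` and the level weight `W_i = 72L^{3m_F}(L^i)³·B_i` (plaquette count × bound).  `exists_depth_threshold`:
for `P ≥ q + 2` there is a depth `h₀` beyond which (i) `W` is dominated by the ratio `¼`, (ii) `38·mbar·W_{h+1} ≤ A_h` (all conditioning defects of
the chain at depth `h` are below the base), (iii) `A_h ≤ ½`, (iv) `B_h ≤ C₁β_h^A e^{−(a/2)p_h²}` (the slack is absorbed into half the Gaussian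
exponent) — four instances of part 1's increment/level domination, written out in product form for the induction of part 5.

HONEST FRAMING.  Bookkeeping only; no estimate of Bałaban's is asserted; the crux `LocalUnitStabilityL` (27016) is untouched; rung R3 is a RECORD
rung — no summit, no Clay claim; the Yang–Mills mass gap is NOT proved by any of this.  No `def`, no `sorry`.

References: T. Bałaban, CMP **102** (1985) 255–275 [Balaban1985UV3] ((3) p.256, (7) p.257).
-/

set_option autoImplicit false

noncomputable section

open scoped BigOperators

namespace Summit.QuantumFields.YangMills.Theorems.HistoryTailOfLocalStability

section Thresholds

variable {L : ℕ} {γ x₀ δ a b₀ R C₁ : ℝ} {A q P mF mbar : ℕ} {p_ Rt A_ B_ W_ : ℕ → ℝ}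

/-- Powers of the block size as exponentials: `(L^i)^3 = exp(3·i·log L)` (`L > 0`). [folklore] -/
theorem pow_pow_three_eq_exp (hL : 0 < L) (i : ℕ) : (((L : ℝ)) ^ i) ^ 3 = Real.exp (3 * (i : ℝ) * Real.log L) := by
  have hL0 : (0 : ℝ) < L := by exact_mod_cast hL
  rw [show (3 : ℝ) * (i : ℝ) * Real.log L = ((3 : ℕ) : ℝ) * (((i : ℕ) : ℝ) * Real.log L) by push_cast; ring,
    Real.exp_nat_mul, Real.exp_nat_mul, Real.exp_log hL0]

/-- **THE DEPTH THRESHOLD** (module docstring). [cite: Balaban1985UV3, (7) p.257] -/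
theorem exists_depth_threshold (hL : 1 < L) (hx₀ : 1 ≤ x₀) (hδ : 0 < δ) (ha : 0 < a) (hb₀ : 0 < b₀) (hR : 0 ≤ R)
    (hC₁ : 0 < C₁) (hm : 0 < mbar) (hP : q + 2 ≤ P)
    (hp : ∀ i, p_ i = b₀ * (x₀ + δ * i) ^ P)
    (hRt : ∀ i, Rt i = R * p_ i * ((mF : ℝ) + i + 1) ^ q)
    (hA : ∀ i, A_ i = C₁ * Real.exp (A * (i * Real.log L - Real.log γ)) * Real.exp (-(a * p_ i ^ 2)))
    (hB : ∀ i, B_ i = 3 * Real.exp (Rt i + 1) * A_ i)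
    (hW : ∀ i, W_ i = 72 * (L : ℝ) ^ (3 * mF) * ((L : ℝ) ^ i) ^ 3 * B_ i) :
    ∃ h₀ : ℕ, (∀ k, h₀ ≤ k → W_ (k + 1) ≤ W_ k / 4) ∧ (∀ h, h₀ ≤ h → 38 * (mbar : ℝ) * W_ (h + 1) ≤ A_ h) ∧
      (∀ h, h₀ ≤ h → A_ h ≤ 1 / 2) ∧
      (∀ h, h₀ ≤ h → B_ h ≤ C₁ * Real.exp (A * (h * Real.log L - Real.log γ)) * Real.exp (-(a / 2 * p_ h ^ 2))) := by
  have hL0 : 0 < L := by omega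
  have hLr : (0 : ℝ) < L := by exact_mod_cast hL0
  have hRt0 : ∀ i, 0 ≤ Rt i := fun i => by
    rw [hRt, hp]
    have : 0 ≤ x₀ + δ * i := by positivity
    positivity
  -- the single-exponential forms
  set Z : ℝ := 216 * (L : ℝ) ^ (3 * mF) * C₁ with hZ
  have hZ0 : 0 < Z := by positivity
  set aexp : ℕ → ℝ := fun i => A * (i * Real.log L - Real.log γ) - a * p_ i ^ 2 with haexp
  set wexp : ℕ → ℝ := fun i => 3 * (i : ℝ) * Real.log L + (Rt i + 1) + aexp i with hwexp
  have hA' : ∀ i, A_ i = C₁ * Real.exp (aexp i) := fun i => by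
    rw [hA]; simp only [haexp, Real.exp_sub, Real.exp_neg]; ring
  have hW' : ∀ i, W_ i = Z * Real.exp (wexp i) := fun i => by
    rw [hW, hB, hA', pow_pow_three_eq_exp hL0]; simp only [hwexp, hZ, Real.exp_add]; ring
  -- the four thresholds
  obtain ⟨h₂, hh₂⟩ := eventually_le_sq_sub_sq (mF := mF) hx₀ hδ ha hb₀ hR hP
    (Real.log 4 + (3 + A) * Real.log L) 0
  obtain ⟨h₃, hh₃⟩ := eventually_le_sq_sub_sq (mF := mF) hx₀ hδ ha hb₀ hR hP
    (Real.log (38 * (mbar : ℝ) * Z / C₁) + (3 + A) * Real.log L + 1) (3 * Real.log L)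
  obtain ⟨h₄, hh₄⟩ := eventually_le_half_sq (mF := mF) hx₀ hδ ha hb₀ hR hP
    (Real.log C₁ + Real.log 2 - A * Real.log γ) (A * Real.log L)
  obtain ⟨h₅, hh₅⟩ := eventually_le_half_sq (mF := mF) hx₀ hδ ha hb₀ hR hP (Real.log 3 + 1) 0
  refine ⟨max h₂ (max h₃ (max h₄ h₅)), fun k hk => ?_, fun h hh => ?_, fun h hh => ?_, fun h hh => ?_⟩
  · -- (i) `W_{k+1} ≤ W_k / 4`
    have hk₂ : h₂ ≤ k := le_trans (le_max_left _ _) hk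
    have G := hh₂ k hk₂
    rw [← hp, ← hp, ← hRt, zero_mul, add_zero] at G
    rw [hW', hW', le_div_iff₀ (by norm_num : (0 : ℝ) < 4)]
    -- `Z e^{w(k+1)} · 4 ≤ Z e^{w k}` ⟸ `w(k+1) + log 4 ≤ w(k)`
    have hlog4 : Real.exp (Real.log 4) = 4 := Real.exp_log (by norm_num)
    have key : wexp (k + 1) + Real.log 4 ≤ wexp k := by
      simp only [hwexp, haexp]
      push_cast
      have := hRt0 k
      nlinarith
    calc Z * Real.exp (wexp (k + 1)) * 4 = Z * Real.exp (wexp (k + 1) + Real.log 4) := by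
          rw [Real.exp_add (wexp (k + 1)) (Real.log 4), hlog4]; ring
      _ ≤ Z * Real.exp (wexp k) := mul_le_mul_of_nonneg_left (Real.exp_le_exp.mpr key) hZ0.le
  · -- (ii) `38 mbar W_{h+1} ≤ A_h`
    have hk₃ : h₃ ≤ h := le_trans (le_trans (le_max_left _ _) (le_max_right _ _)) hh
    have G := hh₃ h hk₃
    rw [← hp, ← hp, ← hRt] at G
    rw [hW', hA']
    have hM : 0 < 38 * (mbar : ℝ) * Z / C₁ := by
      have : (0 : ℝ) < mbar := by exact_mod_cast hm
      positivity
    have hlogM : Real.exp (Real.log (38 * (mbar : ℝ) * Z / C₁)) = 38 * (mbar : ℝ) * Z / C₁ := Real.exp_log hM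
    have key : Real.log (38 * (mbar : ℝ) * Z / C₁) + wexp (h + 1) ≤ aexp h := by
      simp only [hwexp, haexp]
      push_cast
      nlinarith
    calc 38 * (mbar : ℝ) * (Z * Real.exp (wexp (h + 1)))
        = C₁ * (38 * (mbar : ℝ) * Z / C₁ * Real.exp (wexp (h + 1))) := by field_simp
      _ = C₁ * Real.exp (Real.log (38 * (mbar : ℝ) * Z / C₁) + wexp (h + 1)) := by
          rw [Real.exp_add (Real.log (38 * (mbar : ℝ) * Z / C₁)) (wexp (h + 1)), hlogM]
      _ ≤ C₁ * Real.exp (aexp h) := mul_le_mul_of_nonneg_left (Real.exp_le_exp.mpr key) hC₁.le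
  · -- (iii) `A_h ≤ ½`
    have hk₄ : h₄ ≤ h := le_trans (le_trans (le_trans (le_max_left _ _) (le_max_right _ _)) (le_max_right _ _)) hh
    have G := hh₄ h hk₄
    rw [← hp, ← hRt] at G
    rw [hA']
    have hlogC : Real.exp (Real.log C₁) = C₁ := Real.exp_log hC₁
    have hlog2 : Real.exp (Real.log 2) = 2 := Real.exp_log (by norm_num)
    have hp2 : 0 ≤ a / 2 * p_ h ^ 2 := by positivity
    have key : Real.log C₁ + aexp h ≤ -Real.log 2 := by
      simp only [haexp]
      have := hRt0 h
      nlinarith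
    calc C₁ * Real.exp (aexp h) = Real.exp (Real.log C₁ + aexp h) := by rw [Real.exp_add (Real.log C₁) (aexp h), hlogC]
      _ ≤ Real.exp (-Real.log 2) := Real.exp_le_exp.mpr key
      _ = 1 / 2 := by rw [Real.exp_neg, hlog2, one_div]
  · -- (iv) `B_h ≤ C₁ β_h^A e^{−(a/2) p_h²}`
    have hk₅ : h₅ ≤ h := le_trans (le_trans (le_trans (le_max_right _ _) (le_max_right _ _)) (le_max_right _ _)) hh
    have G := hh₅ h hk₅
    rw [← hp, ← hRt, zero_mul, add_zero] at G
    rw [hB, hA]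
    have hlog3 : Real.exp (Real.log 3) = 3 := Real.exp_log (by norm_num)
    have key : Real.log 3 + (Rt h + 1) + -(a * p_ h ^ 2) ≤ -(a / 2 * p_ h ^ 2) := by nlinarith
    have hE0 : 0 ≤ C₁ * Real.exp (A * (h * Real.log L - Real.log γ)) := by positivity
    calc 3 * Real.exp (Rt h + 1) * (C₁ * Real.exp (A * (h * Real.log L - Real.log γ)) * Real.exp (-(a * p_ h ^ 2)))
        = C₁ * Real.exp (A * (h * Real.log L - Real.log γ)) * Real.exp (Real.log 3 + (Rt h + 1) + -(a * p_ h ^ 2)) := by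
          rw [Real.exp_add (Real.log 3 + (Rt h + 1)) (-(a * p_ h ^ 2)), Real.exp_add (Real.log 3) (Rt h + 1), hlog3]; ring
      _ ≤ C₁ * Real.exp (A * (h * Real.log L - Real.log γ)) * Real.exp (-(a / 2 * p_ h ^ 2)) :=
          mul_le_mul_of_nonneg_left (Real.exp_le_exp.mpr key) hE0

end Thresholds

end Summit.QuantumFields.YangMills.Theorems.HistoryTailOfLocalStability

end
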